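import Literature.IUT.LogVolume.WildCubicIsometryMover
import HarnessLib

/-!
# A wild DYADIC isometry MOVING the maximal order of a tensor packet: `K = ℚ₂(√2)`, `(g ⊗ 1)((R_I)^∼) ≠ (R_I)^∼`

Classical local algebra (nothing disputed; the [IUTchIV] locator records where the abc-iut cell uses it).
[IUTchIV] Prop. 1.1 p. 9 attaches to a tensor packet `V = ⊗_{ℚ_p} k_i` the integral structure `R_I = ⊗_{ℤ_p} R_i`
and its normalisation `(R_I)^∼`, the MAXIMAL `ℤ_p`-order of `V`.  `WildCubicIsometryMover.lean` (abc-iut-E-t47) shows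
that a factorwise `ℚ_p`-linear ISOMETRY need not preserve `(R_I)^∼` at the smallest ODD wild factor `ℚ₃(∛3)` (a
coordinate REFLECTION).  THIS FILE is the smallest DYADIC example `K = ℚ₂(π)`, `π² = 2`:
* `WildQuadratic.norm_combo` — `‖a·1 + b·π‖ = max(‖a‖, ‖b‖‖π‖)` (the squares of the two absolute values are an even
  resp. an odd power of `2`); `WildQuadratic.linearIndependent_one_pi`;
* `WildQuadratic.quadIdempotent_mem_normalizedPacket` — the idempotent `z = ½·1⊗1 + ¼·π⊗π` of `K ⊗_{ℚ₂} K` is in `(R_I)^∼`;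
* `WildQuadratic.congr_pair_quadIdempotent(_not_mem)` — for ANY `ℚ₂`-linear `f₀, f₁` with `f₀ 1 = 1 + π`, `f₀ π = π`,
  `f₁` fixing `1, π`: `(f₀ ⊗ f₁)(z) = z + ½·π⊗1 ∉ (R_I)^∼` (the square of `½·π⊗1` is `½·1`, `‖½‖₂ = 2`);
* **`WildQuadratic.exists_transvection_isometry`** — for `[K : ℚ₂] = 2` the TRANSVECTION `x = a + bπ ↦ x + a·π`
  (`1 ↦ 1 + π`, `π ↦ π`) is a `ℚ₂`-linear ISOMETRY (so it maps `𝒪_K` and every `𝔪_K^n` onto themselves).  The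
  REFLECTION `a + bπ ↦ −a + bπ` of the cubic file is NOT a mover here: it is `−σ` for the conjugation `σ : π ↦ −π`;
* **`WildQuadratic.exists_isometry_maxOrder_mover`**, **`exists_wildQuadratic_isometry_maxOrder_mover`** — basis-free
  form and NON-VACUITY inside `ℚ̄₂` (`E = ℚ₂(√2)`, `exists_wildQuadratic_subfield`).
Use (abc-iut cell, R-J row Y-29b, dyadic half): «𝒪_v-stable `ℚ_p`-linear ISOMETRIES as the (Ind2)-binder» need not
fix the maximal-order boxes `e⁻¹(𝒪_L)` of the tensor packets at a wild DYADIC place either.  A statement about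
CONTAINERS only; it takes no side on [IUTchIII] Cor. 3.12.  Proof-only file (theorems, no definitions).
[cite: Mochizuki2012, IUTchIV Prop. 1.1 p. 9, Prop. 1.4 (i) p. 13] [cite: NeukirchANT1999, Ch. II (5.5)]
[cite: SerreLocalFields1979, Ch. III §6 Prop. 12]
-/

noncomputable section

open Metric Set
open scoped TensorProduct Pointwise

namespace Literature.IUT.LogVolume

namespace WildQuadratic

variable {K : Type} [NontriviallyNormedField K] [NormedAlgebra ℚ_[2] K]

/-! ## Absolute values in `K ⊇ ℚ₂(π)`, `π² = 2` -/

variable {π : K}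

/-- `‖π‖² = ‖2‖ = 1/2` when `π² = 2` (abc-iut-w5-d172's `WildDyadic.norm_two`, inlined). [cite: NeukirchANT1999, Ch. II (5.5)] -/
theorem norm_pi_sq (hπ : π ^ 2 = 2) : ‖π‖ ^ 2 = 2⁻¹ := by
  rw [← norm_pow, hπ, ← map_ofNat (algebraMap ℚ_[2] K) 2, norm_algebraMap']
  simpa using Padic.norm_p (p := 2)

/-- `0 < ‖π‖`. [cite: NeukirchANT1999, Ch. II (5.5)] -/
theorem norm_pi_pos (hπ : π ^ 2 = 2) : 0 < ‖π‖ := by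
  rcases (norm_nonneg π).eq_or_lt with h0 | h0
  · have h := norm_pi_sq hπ
    rw [← h0] at h
    norm_num at h
  · exact h0

/-- `‖π‖ < 1`. [cite: NeukirchANT1999, Ch. II (5.5)] -/
theorem norm_pi_lt_one (hπ : π ^ 2 = 2) : ‖π‖ < 1 := by
  refine lt_of_not_ge fun h => ?_
  have h1 : (1 : ℝ) ≤ ‖π‖ ^ 2 := one_le_pow₀ h
  rw [norm_pi_sq hπ] at h1
  norm_num at h1

/-- `‖a • 1‖ = ‖a‖` for `a ∈ ℚ₂`. [cite: NeukirchANT1999, Ch. II (5.5)] -/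
theorem norm_smul_one (a : ℚ_[2]) : ‖a • (1 : K)‖ = ‖a‖ := by
  rw [norm_smul, norm_one, mul_one]

/-- The square of `‖a‖·‖π‖^i` is `2^{−(2·ord(a) + i)}` (`a ≠ 0`). [cite: NeukirchANT1999, Ch. II (5.5)] -/
theorem norm_smul_pi_pow_sq (hπ : π ^ 2 = 2) {a : ℚ_[2]} (ha : a ≠ 0) (i : ℕ) :
    (‖a‖ * ‖π‖ ^ i) ^ 2 = (2 : ℝ) ^ (-(2 * a.valuation + i)) := by
  have h2 : ((2 : ℕ) : ℝ) = 2 := by norm_num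
  rw [Padic.norm_eq_zpow_neg_valuation ha, h2, mul_pow, ← pow_mul, mul_comm i 2, pow_mul,
    norm_pi_sq hπ, ← zpow_natCast ((2 : ℝ) ^ (-a.valuation)) 2, ← zpow_mul, inv_pow,
    ← zpow_natCast (2 : ℝ) i, ← zpow_neg, ← zpow_add₀ (by norm_num : (2 : ℝ) ≠ 0)]
  congr 1
  push_cast
  ring

/-- `‖a‖ ≠ ‖b‖·‖π‖` for `a, b ≠ 0` (an even and an odd power of `√2⁻¹`). [cite: NeukirchANT1999, Ch. II (5.5)] -/
theorem norm_ne_norm_mul_norm_pi (hπ : π ^ 2 = 2) {a b : ℚ_[2]} (ha : a ≠ 0) (hb : b ≠ 0) :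
    ‖a‖ ≠ ‖b‖ * ‖π‖ := by
  intro h
  have h' : ‖a‖ * ‖π‖ ^ 0 = ‖b‖ * ‖π‖ ^ 1 := by rw [pow_zero, mul_one, pow_one]; exact h
  have h3 := congrArg (fun x : ℝ => x ^ 2) h'
  simp only [norm_smul_pi_pow_sq hπ ha, norm_smul_pi_pow_sq hπ hb] at h3
  have hinj := zpow_right_injective₀ (by norm_num : (0 : ℝ) < 2) (by norm_num : (2 : ℝ) ≠ 1) h3
  omega

/-- **`‖a·1 + b·π‖ = max(‖a‖, ‖b‖·‖π‖)`** (`a, b ∈ ℚ₂`): `(1, π)` is an ORTHOGONAL basis of `ℚ₂(π)` (abc-iut-S1's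
`WildCubic.norm_add_eq_max_of` with the distinctness above). [cite: NeukirchANT1999, Ch. II (5.5)] -/
theorem norm_combo [IsUltrametricDist K] (hπ : π ^ 2 = 2) (a b : ℚ_[2]) :
    ‖a • (1 : K) + b • π‖ = max ‖a‖ (‖b‖ * ‖π‖) := by
  rw [WildCubic.norm_add_eq_max_of, norm_smul_one, norm_smul]
  by_cases ha : a = 0
  · left; rw [ha, zero_smul]
  by_cases hb : b = 0
  · right; left; rw [hb, zero_smul]
  right; right
  rw [norm_smul_one, norm_smul]
  exact norm_ne_norm_mul_norm_pi hπ ha hb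

/-- `1, π` are `ℚ₂`-linearly independent, so they form a basis as soon as `[K : ℚ₂] = 2`.
[cite: NeukirchANT1999, Ch. II (5.5)] -/
theorem linearIndependent_one_pi [IsUltrametricDist K] (hπ : π ^ 2 = 2) :
    LinearIndependent ℚ_[2] ![(1 : K), π] := by
  rw [Fintype.linearIndependent_iff]
  intro g hg
  have hg' : g 0 • (1 : K) + g 1 • π = 0 := by simpa [Fin.sum_univ_two] using hg
  have h := norm_combo hπ (g 0) (g 1)
  rw [hg', norm_zero] at h
  have h0 : ‖g 0‖ ≤ 0 := by rw [h]; exact le_max_left _ _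
  have h1 : ‖g 1‖ * ‖π‖ ≤ 0 := by rw [h]; exact le_max_right _ _
  have e0 : g 0 = 0 := norm_le_zero_iff.mp h0
  have e1 : g 1 = 0 := norm_le_zero_iff.mp (le_of_mul_le_mul_right (by simpa using h1) (norm_pi_pos hπ))
  intro i
  fin_cases i
  · exact e0
  · exact e1

/-! ## Coordinates with respect to the basis `(1, π)` and the TRANSVECTION `x ↦ x + x₀·π` -/

section Basis

variable (B : Module.Basis (Fin 2) ℚ_[2] K)

/-- `x = x₀·1 + x₁·π` with `xᵢ = B.repr x i`. [cite: NeukirchANT1999, Ch. II (5.5)] -/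
theorem eq_combo (hB0 : B 0 = 1) (hB1 : B 1 = π) (x : K) : x = B.repr x 0 • (1 : K) + B.repr x 1 • π := by
  have h := B.sum_repr x
  rw [Fin.sum_univ_two, hB0, hB1] at h
  exact h.symm

/-- **The transvection is norm-preserving**: `‖x + x₀·π‖ = ‖x‖` (`x₀ = B.repr x 0`).  In coordinates
`(x₀, x₁) ↦ (x₀, x₁ + x₀)`: if `‖x₁‖ ≤ ‖x₀‖` both norms are `‖x₀‖` (`‖π‖ < 1`), otherwise `‖x₁ + x₀‖ = ‖x₁‖`.
[cite: NeukirchANT1999, Ch. II (5.5)] -/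
theorem norm_add_repr_smul_pi [IsUltrametricDist K] (hπ : π ^ 2 = 2) (hB0 : B 0 = 1) (hB1 : B 1 = π) (x : K) :
    ‖x + B.repr x 0 • π‖ = ‖x‖ := by
  have hπ1 := norm_pi_lt_one hπ
  set a := B.repr x 0 with ha
  set b := B.repr x 1 with hb
  have hx : x = a • (1 : K) + b • π := eq_combo B hB0 hB1 x
  have hx' : x + a • π = a • (1 : K) + (b + a) • π := by rw [hx, add_smul]; abel
  rw [hx', norm_combo hπ, hx, norm_combo hπ]
  rcases le_or_gt ‖b‖ ‖a‖ with hle | hlt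
  · -- both maxima are `‖a‖`
    have hba : ‖b + a‖ ≤ ‖a‖ := (IsUltrametricDist.norm_add_le_max b a).trans (max_le hle le_rfl)
    have h1 : ‖b + a‖ * ‖π‖ ≤ ‖a‖ := (mul_le_mul hba hπ1.le (norm_nonneg _) (norm_nonneg _)).trans (mul_one _).le
    have h2 : ‖b‖ * ‖π‖ ≤ ‖a‖ := (mul_le_mul hle hπ1.le (norm_nonneg _) (norm_nonneg _)).trans (mul_one _).le
    rw [max_eq_left h1, max_eq_left h2]
  · -- `‖b + a‖ = ‖b‖`
    rw [IsUltrametricDist.norm_add_eq_max_of_norm_ne_norm (ne_of_gt hlt), max_eq_left hlt.le]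

/-- **The TRANSVECTION `x ↦ x + x₀·π` as a `ℚ₂`-linear ISOMETRY** with `1 ↦ 1 + π`, `π ↦ π` (inverse
`x ↦ x − x₀·π`, since `(π)₀ = 0`). [cite: NeukirchANT1999, Ch. II (5.5)] -/
theorem exists_transvection_isometry_of_basis [IsUltrametricDist K] (hπ : π ^ 2 = 2) (hB0 : B 0 = 1)
    (hB1 : B 1 = π) : ∃ f₀ : K ≃ₗ[ℚ_[2]] K, f₀ 1 = 1 + π ∧ f₀ π = π ∧ ∀ x, ‖f₀ x‖ = ‖x‖ := by
  -- coordinates of `π` and `1` (abc-iut-S1's `WildCubic.repr_*` pattern)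
  have hrπ : B.repr π 0 = 0 := by rw [← hB1, B.repr_self]; simp
  have hr1 : B.repr 1 0 = 1 := by rw [← hB0, B.repr_self]; simp
  let T : K →ₗ[ℚ_[2]] K := (B.coord 0).smulRight π
  have hT : ∀ x, T x = B.repr x 0 • π := fun x => rfl
  have hTT : ∀ x, T (T x) = 0 := by
    intro x
    rw [hT, hT, map_smul, Finsupp.smul_apply, hrπ, smul_zero, zero_smul]
  have h1 : (LinearMap.id + T).comp (LinearMap.id - T) = LinearMap.id := by
    ext x; simp only [LinearMap.comp_apply, LinearMap.sub_apply, LinearMap.id_apply, LinearMap.add_apply, map_sub, hTT]; abel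
  have h2 : (LinearMap.id - T).comp (LinearMap.id + T) = LinearMap.id := by
    ext x; simp only [LinearMap.comp_apply, LinearMap.sub_apply, LinearMap.id_apply, LinearMap.add_apply, map_add, hTT]; abel
  refine ⟨LinearEquiv.ofLinear (LinearMap.id + T) (LinearMap.id - T) h1 h2, ?_, ?_, fun x => ?_⟩
  · show (1 : K) + T 1 = 1 + π; rw [hT, hr1, one_smul]
  · show π + T π = π; rw [hT, hrπ, zero_smul, add_zero]
  · show ‖x + T x‖ = ‖x‖; rw [hT]; exact norm_add_repr_smul_pi B hπ hB0 hB1 x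

end Basis

/-- **The transvection is a `ℚ₂`-linear ISOMETRY of `K = ℚ₂(π)`** (`[K : ℚ₂] = 2`, `π² = 2`): there is
`f₀ : K ≃ₗ[ℚ₂] K` with `f₀ 1 = 1 + π`, `f₀ π = π` and `‖f₀ x‖ = ‖x‖` for all `x`. [cite: NeukirchANT1999, Ch. II (5.5)] -/
theorem exists_transvection_isometry [IsUltrametricDist K] (hK : Module.finrank ℚ_[2] K = 2) (hπ : π ^ 2 = 2) :
    ∃ f₀ : K ≃ₗ[ℚ_[2]] K, f₀ 1 = 1 + π ∧ f₀ π = π ∧ ∀ x, ‖f₀ x‖ = ‖x‖ := by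
  have hli := linearIndependent_one_pi hπ
  let B := basisOfLinearIndependentOfCardEqFinrank hli (by rw [hK, Fintype.card_fin])
  have hB : ⇑B = ![(1 : K), π] := coe_basisOfLinearIndependentOfCardEqFinrank _ _
  have hB0 : B 0 = 1 := by rw [hB]; rfl
  have hB1 : B 1 = π := by rw [hB]; rfl
  exact exists_transvection_isometry_of_basis B hπ hB0 hB1

/-! ## The two-factor packet `K ⊗_{ℚ₂} K`: the idempotent `z = ½·1⊗1 + ¼·π⊗π` and its image under `f₀ ⊗ f₁` -/

/-- `(f₀ ⊗ f₁)(x ⊗ y) = f₀ x ⊗ f₁ y` on the two-factor packet. [cite: Mochizuki2012, IUTchIV Prop. 1.1 p. 9] -/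
theorem congr_pair_purePacket (f : ∀ _ : Fin 2, K ≃ₗ[ℚ_[2]] K) (x y : K) :
    (PiTensorProduct.congr f : PacketAlgebra 2 (fun _ : Fin 2 => K) ≃ₗ[ℚ_[2]] PacketAlgebra 2 (fun _ : Fin 2 => K))
        (purePacket 2 (fun _ : Fin 2 => K) ![x, y]) =
      purePacket 2 (fun _ : Fin 2 => K) ![f 0 x, f 1 y] := by
  rw [purePacket, purePacket, PiTensorProduct.congr_tprod]
  congr 1
  funext i
  fin_cases i <;> rfl

/-- Pure tensors of the two-factor packet multiply factorwise: `⊗(x, y)·⊗(x', y') = ⊗(xx', yy')`.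
[cite: Mochizuki2012, IUTchIV Prop. 1.1 p. 9] -/
theorem purePacket_pair_mul (x y x' y' : K) :
    purePacket 2 (fun _ : Fin 2 => K) ![x, y] * purePacket 2 (fun _ : Fin 2 => K) ![x', y'] =
      purePacket 2 (fun _ : Fin 2 => K) ![x * x', y * y'] := by
  rw [purePacket_mul]
  congr 1
  funext i
  fin_cases i <;> simp

/-- `⊗(x, y) = ι₀(x)·ι₁(y)`. [cite: Mochizuki2012, IUTchIV Prop. 1.1 p. 9] -/
theorem purePacket_pair_eq_iota_mul (x y : K) :
    purePacket 2 (fun _ : Fin 2 => K) ![x, y] =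
      iota 2 (fun _ : Fin 2 => K) 0 x * iota 2 (fun _ : Fin 2 => K) 1 y := by
  classical
  rw [purePacket_eq_prod_iota, Fin.prod_univ_two]
  rfl

/-- Additivity in the first slot: `⊗(x + x', y) = ⊗(x, y) + ⊗(x', y)`. [cite: Mochizuki2012, IUTchIV Prop. 1.1 p. 9] -/
theorem purePacket_pair_add_left (x x' y : K) :
    purePacket 2 (fun _ : Fin 2 => K) ![x + x', y] =
      purePacket 2 (fun _ : Fin 2 => K) ![x, y] + purePacket 2 (fun _ : Fin 2 => K) ![x', y] := by
  rw [purePacket_pair_eq_iota_mul, purePacket_pair_eq_iota_mul, purePacket_pair_eq_iota_mul, map_add, add_mul]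

/-- `⊗(1, 1) = 1`. [cite: Mochizuki2012, IUTchIV Prop. 1.1 p. 9] -/
theorem purePacket_pair_one : purePacket 2 (fun _ : Fin 2 => K) ![1, 1] = 1 := by
  have hone : (![(1 : K), 1] : Fin 2 → K) = 1 := by funext i; fin_cases i <;> rfl
  rw [hone, purePacket_one]

/-- `⊗(π, π)² = 4` (`π² = 2`). [cite: Mochizuki2012, IUTchIV Prop. 1.1 p. 9] -/
theorem purePacket_pi_pi_mul_self (hπ : π ^ 2 = 2) :
    purePacket 2 (fun _ : Fin 2 => K) ![π, π] * purePacket 2 (fun _ : Fin 2 => K) ![π, π] = 4 := by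
  have h2 : π * π = (2 : ℚ_[2]) • (1 : K) := by rw [← sq, hπ, Algebra.smul_def, map_ofNat, mul_one]
  have h : (![(2 : ℚ_[2]) • (1 : K), (2 : ℚ_[2]) • (1 : K)] : Fin 2 → K) =
      fun i => (![(2 : ℚ_[2]), 2] : Fin 2 → ℚ_[2]) i • (1 : Fin 2 → K) i := by
    funext i
    fin_cases i <;> simp
  rw [purePacket_pair_mul, h2, h, purePacket_smul, purePacket_one, Fin.prod_univ_two, Algebra.smul_def, mul_one]
  simp only [Matrix.cons_val_zero, Matrix.cons_val_one]
  rw [show (2 : ℚ_[2]) * 2 = 4 by norm_num, map_ofNat]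

/-- `⊗(π, 1)² = 2` (`π² = 2`). [cite: Mochizuki2012, IUTchIV Prop. 1.1 p. 9] -/
theorem purePacket_pi_one_mul_self (hπ : π ^ 2 = 2) :
    purePacket 2 (fun _ : Fin 2 => K) ![π, 1] * purePacket 2 (fun _ : Fin 2 => K) ![π, 1] = 2 := by
  have h2 : π * π = (2 : ℚ_[2]) • (1 : K) := by rw [← sq, hπ, Algebra.smul_def, map_ofNat, mul_one]
  have h : (![(2 : ℚ_[2]) • (1 : K), (1 : K) * 1] : Fin 2 → K) =
      fun i => (![(2 : ℚ_[2]), 1] : Fin 2 → ℚ_[2]) i • (1 : Fin 2 → K) i := by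
    funext i
    fin_cases i <;> simp
  rw [purePacket_pair_mul, h2, h, purePacket_smul, purePacket_one, Fin.prod_univ_two, Algebra.smul_def, mul_one]
  simp only [Matrix.cons_val_zero, Matrix.cons_val_one]
  rw [mul_one, map_ofNat]

/-- **The idempotent** `z = ½·1 + ¼·π⊗π` of `K ⊗_{ℚ₂} K` (`π² = 2`): `z² = z` (with `W := 2 + π⊗π`, `W² = 4W`).
[cite: Mochizuki2012, IUTchIV Prop. 1.1 p. 9] -/
theorem quadIdempotent_mul_self (hπ : π ^ 2 = 2) :
    (4 : ℚ_[2])⁻¹ • ((2 : PacketAlgebra 2 (fun _ : Fin 2 => K)) + purePacket 2 (fun _ : Fin 2 => K) ![π, π]) *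
        (4 : ℚ_[2])⁻¹ • ((2 : PacketAlgebra 2 (fun _ : Fin 2 => K)) + purePacket 2 (fun _ : Fin 2 => K) ![π, π]) =
      (4 : ℚ_[2])⁻¹ • ((2 : PacketAlgebra 2 (fun _ : Fin 2 => K)) + purePacket 2 (fun _ : Fin 2 => K) ![π, π]) := by
  set P := purePacket 2 (fun _ : Fin 2 => K) ![π, π]
  have hW : (2 + P) * (2 + P) = 4 * (2 + P) := by
    linear_combination purePacket_pi_pi_mul_self hπ
  have h4 : (4 : PacketAlgebra 2 (fun _ : Fin 2 => K)) * (2 + P) = (4 : ℚ_[2]) • (2 + P) := by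
    rw [Algebra.smul_def, map_ofNat]
  rw [smul_mul_smul_comm, hW, h4, smul_smul, show (4 : ℚ_[2])⁻¹ * 4⁻¹ * 4 = 4⁻¹ by norm_num]

/-- `z ∈ (R_I)^∼`: an idempotent is integral (root of `X² − X`). [cite: Mochizuki2012, IUTchIV Prop. 1.1 p. 9] -/
theorem quadIdempotent_mem_normalizedPacket (hπ : π ^ 2 = 2) :
    (4 : ℚ_[2])⁻¹ • ((2 : PacketAlgebra 2 (fun _ : Fin 2 => K)) + purePacket 2 (fun _ : Fin 2 => K) ![π, π]) ∈
      normalizedPacket 2 (fun _ : Fin 2 => K) := by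
  rw [mem_normalizedPacket_iff]
  refine ⟨Polynomial.X * (Polynomial.X - Polynomial.C 1),
    Polynomial.monic_X.mul (Polynomial.monic_X_sub_C 1), ?_⟩
  rw [Polynomial.eval₂_mul, Polynomial.eval₂_sub, Polynomial.eval₂_X, Polynomial.eval₂_C, map_one,
    mul_sub, mul_one, quadIdempotent_mul_self hπ, sub_self]

/-- `2 = 2·⊗(1, 1)` in the packet. [cite: Mochizuki2012, IUTchIV Prop. 1.1 p. 9] -/
theorem two_eq_smul_purePacket_one :
    (2 : PacketAlgebra 2 (fun _ : Fin 2 => K)) = (2 : ℚ_[2]) • purePacket 2 (fun _ : Fin 2 => K) ![1, 1] := by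
  rw [purePacket_pair_one, Algebra.smul_def, mul_one, map_ofNat]

/-- **`(f₀ ⊗ f₁)(z) = z + ½·π⊗1`** for the idempotent `z = ½·1 + ¼·π⊗π` and ANY `ℚ₂`-linear `f₀`, `f₁` with
`f₀ 1 = 1 + π`, `f₀ π = π` and `f₁` fixing `1, π` (`f₀ ⊗ f₁` moves `½·1⊗1` to `½·(1+π)⊗1` and fixes `¼·π⊗π`).
[cite: Mochizuki2012, IUTchIV Prop. 1.1 p. 9] -/
theorem congr_pair_quadIdempotent (f : ∀ _ : Fin 2, K ≃ₗ[ℚ_[2]] K) (h0 : f 0 1 = 1 + π) (h0π : f 0 π = π)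
    (h1 : f 1 1 = 1) (h1π : f 1 π = π) :
    (PiTensorProduct.congr f : PacketAlgebra 2 (fun _ : Fin 2 => K) ≃ₗ[ℚ_[2]] PacketAlgebra 2 (fun _ : Fin 2 => K))
        ((4 : ℚ_[2])⁻¹ • ((2 : PacketAlgebra 2 (fun _ : Fin 2 => K)) + purePacket 2 (fun _ : Fin 2 => K) ![π, π])) =
      (4 : ℚ_[2])⁻¹ • ((2 : PacketAlgebra 2 (fun _ : Fin 2 => K)) + purePacket 2 (fun _ : Fin 2 => K) ![π, π]) +
        (2 : ℚ_[2])⁻¹ • purePacket 2 (fun _ : Fin 2 => K) ![π, 1] := by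
  set P11 := purePacket 2 (fun _ : Fin 2 => K) ![1, 1] with hP11
  set Pππ := purePacket 2 (fun _ : Fin 2 => K) ![π, π] with hPππ
  set Pπ1 := purePacket 2 (fun _ : Fin 2 => K) ![π, 1] with hPπ1
  have hG1 : (PiTensorProduct.congr f : PacketAlgebra 2 (fun _ : Fin 2 => K) ≃ₗ[ℚ_[2]] PacketAlgebra 2 (fun _ : Fin 2 => K))
      P11 = P11 + Pπ1 := by
    rw [hP11, congr_pair_purePacket, h0, h1, purePacket_pair_add_left]
  have hGππ : (PiTensorProduct.congr f : PacketAlgebra 2 (fun _ : Fin 2 => K) ≃ₗ[ℚ_[2]] PacketAlgebra 2 (fun _ : Fin 2 => K))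
      Pππ = Pππ := by
    rw [hPππ, congr_pair_purePacket, h0π, h1π]
  rw [two_eq_smul_purePacket_one, ← hP11, map_smul, map_add, map_smul, hG1, hGππ]
  module

/-- **`½·π⊗1 ∉ (R_I)^∼`**: its square is `½·1`, and `‖½‖₂ = 2 > 1`. [cite: Mochizuki2012, IUTchIV Prop. 1.1 p. 9, Prop. 1.4 (i) p. 13] -/
theorem half_purePacket_pi_one_not_mem [IsUltrametricDist K] [ProperSpace K] (hπ : π ^ 2 = 2) :
    (2 : ℚ_[2])⁻¹ • purePacket 2 (fun _ : Fin 2 => K) ![π, 1] ∉ normalizedPacket 2 (fun _ : Fin 2 => K) := by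
  intro hmem
  have hsq := mul_mem hmem hmem
  rw [smul_mul_smul_comm, purePacket_pi_one_mul_self hπ,
    show (2 : PacketAlgebra 2 (fun _ : Fin 2 => K)) = algebraMap ℚ_[2] _ 2 from (map_ofNat _ 2).symm,
    Algebra.smul_def, ← map_mul] at hsq
  refine algebraMap_not_mem_normalizedPacket 2 (fun _ : Fin 2 => K) ?_ hsq
  have h2 : ‖(2 : ℚ_[2])‖ = 2⁻¹ := by simpa using Padic.norm_p (p := 2)
  rw [show (2 : ℚ_[2])⁻¹ * 2⁻¹ * 2 = 2⁻¹ by norm_num, norm_inv, h2]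
  norm_num

/-- **`(f₀ ⊗ f₁)(z) ∉ (R_I)^∼`** (else `(f₀ ⊗ f₁)(z) − z = ½·π⊗1 ∈ (R_I)^∼`, a subring containing `z`).
[cite: Mochizuki2012, IUTchIV Prop. 1.1 p. 9, Prop. 1.4 (i) p. 13] -/
theorem congr_pair_quadIdempotent_not_mem [IsUltrametricDist K] [ProperSpace K] (hπ : π ^ 2 = 2)
    (f : ∀ _ : Fin 2, K ≃ₗ[ℚ_[2]] K) (h0 : f 0 1 = 1 + π) (h0π : f 0 π = π) (h1 : f 1 1 = 1) (h1π : f 1 π = π) :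
    (PiTensorProduct.congr f : PacketAlgebra 2 (fun _ : Fin 2 => K) ≃ₗ[ℚ_[2]] PacketAlgebra 2 (fun _ : Fin 2 => K))
        ((4 : ℚ_[2])⁻¹ • ((2 : PacketAlgebra 2 (fun _ : Fin 2 => K)) + purePacket 2 (fun _ : Fin 2 => K) ![π, π])) ∉
      normalizedPacket 2 (fun _ : Fin 2 => K) := by
  intro hmem
  have hz := quadIdempotent_mem_normalizedPacket (K := K) hπ
  have hsub := sub_mem hmem hz
  rw [congr_pair_quadIdempotent f h0 h0π h1 h1π, add_sub_cancel_left] at hsub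
  exact half_purePacket_pi_one_not_mem hπ hsub

/-- **`f₀ ⊗ f₁` moves a point of `(R_I)^∼` out of `(R_I)^∼`** (the idempotent `z`). [cite: Mochizuki2012, IUTchIV Prop. 1.1 p. 9] -/
theorem exists_mem_normalizedPacket_congr_not_mem [IsUltrametricDist K] [ProperSpace K] (hπ : π ^ 2 = 2)
    (f : ∀ _ : Fin 2, K ≃ₗ[ℚ_[2]] K) (h0 : f 0 1 = 1 + π) (h0π : f 0 π = π) (h1 : f 1 1 = 1) (h1π : f 1 π = π) :
    ∃ z : PacketAlgebra 2 (fun _ : Fin 2 => K),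
      z ∈ (normalizedPacket 2 (fun _ : Fin 2 => K) : Set (PacketAlgebra 2 (fun _ : Fin 2 => K))) ∧
        (PiTensorProduct.congr f : PacketAlgebra 2 (fun _ : Fin 2 => K) ≃ₗ[ℚ_[2]] PacketAlgebra 2 (fun _ : Fin 2 => K)) z ∉
          (normalizedPacket 2 (fun _ : Fin 2 => K) : Set (PacketAlgebra 2 (fun _ : Fin 2 => K))) :=
  ⟨_, quadIdempotent_mem_normalizedPacket (K := K) hπ, congr_pair_quadIdempotent_not_mem hπ f h0 h0π h1 h1π⟩

/-- **WILD DYADIC ISOMETRY MOVER (basis-free form).**  `[K : ℚ₂] = 2`, `π² = 2`: there is a `ℚ₂`-linear isometry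
`f₀` of `K` (`‖f₀ x‖ = ‖x‖`, so `f₀(𝒪_K) = 𝒪_K` and `f₀(𝔪^n) = 𝔪^n`) and a point `z` of the maximal order `(R_I)^∼` of
`K ⊗_{ℚ₂} K` with `(f₀ ⊗ 1)(z) ∉ (R_I)^∼`. [cite: Mochizuki2012, IUTchIV Prop. 1.1 p. 9] [cite: NeukirchANT1999, Ch. II (5.5)] -/
theorem exists_isometry_maxOrder_mover [IsUltrametricDist K] [ProperSpace K] (hK : Module.finrank ℚ_[2] K = 2)
    (hπ : π ^ 2 = 2) :
    ∃ f₀ : K ≃ₗ[ℚ_[2]] K, (∀ x, ‖f₀ x‖ = ‖x‖) ∧ (∀ r : ℝ, f₀ '' closedBall (0 : K) r = closedBall 0 r) ∧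
      ∃ z : PacketAlgebra 2 (fun _ : Fin 2 => K),
        z ∈ (normalizedPacket 2 (fun _ : Fin 2 => K) : Set (PacketAlgebra 2 (fun _ : Fin 2 => K))) ∧
          (PiTensorProduct.congr (![f₀, LinearEquiv.refl ℚ_[2] K] : ∀ _ : Fin 2, K ≃ₗ[ℚ_[2]] K) :
              PacketAlgebra 2 (fun _ : Fin 2 => K) ≃ₗ[ℚ_[2]] PacketAlgebra 2 (fun _ : Fin 2 => K)) z ∉
            (normalizedPacket 2 (fun _ : Fin 2 => K) : Set (PacketAlgebra 2 (fun _ : Fin 2 => K))) := by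
  obtain ⟨f₀, h0, h0π, hiso⟩ := exists_transvection_isometry (K := K) hK hπ
  exact ⟨f₀, hiso, image_closedBall_eq_of_norm_map_eq 2 f₀ hiso,
    exists_mem_normalizedPacket_congr_not_mem hπ _ h0 h0π rfl rfl⟩

end WildQuadratic

/-! ## Non-vacuity: `ℚ₂(√2) ⊆ ℚ̄₂` -/

open Polynomial IntermediateField in
/-- **A wildly ramified quadratic subfield of `ℚ̄₂`**: there are `E ⊆ ℚ̄₂`, finite over `ℚ₂` with `[E : ℚ₂] = 2`, and
`π ∈ E` with `π² = 2` (`≤ 2`: the minimal polynomial divides `X² − 2`; `≥ 2`: `1, π` are linearly independent).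
[cite: Mochizuki2012, IUTchIV Prop. 1.1 p. 9] -/
theorem exists_wildQuadratic_subfield :
    ∃ (E : IntermediateField ℚ_[2] (PadicAlgCl 2)) (π : E), FiniteDimensional ℚ_[2] E ∧
      Module.finrank ℚ_[2] E = 2 ∧ π ^ 2 = 2 := by
  obtain ⟨α, hα⟩ := IsAlgClosed.exists_pow_nat_eq (2 : PadicAlgCl 2) (by norm_num : 0 < 2)
  have h2 : algebraMap ℚ_[2] (PadicAlgCl 2) 2 = 2 := map_ofNat _ 2
  have heval : Polynomial.aeval α (X ^ 2 - C (2 : ℚ_[2])) = 0 := by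
    simp [hα, h2]
  have hint : IsIntegral ℚ_[2] α := ⟨X ^ 2 - C 2, monic_X_pow_sub_C 2 (by norm_num), by
    simpa [Polynomial.aeval_def] using heval⟩
  haveI hfd : FiniteDimensional ℚ_[2] ℚ_[2]⟮α⟯ := adjoin.finiteDimensional hint
  have hπE : (⟨α, mem_adjoin_simple_self ℚ_[2] α⟩ : ℚ_[2]⟮α⟯) ^ 2 = 2 := by
    apply Subtype.ext
    have h2E : ((2 : ℚ_[2]⟮α⟯) : PadicAlgCl 2) = 2 := map_ofNat (algebraMap ℚ_[2]⟮α⟯ (PadicAlgCl 2)) 2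
    simp [hα, h2E]
  refine ⟨ℚ_[2]⟮α⟯, ⟨α, mem_adjoin_simple_self ℚ_[2] α⟩, hfd, le_antisymm ?_ ?_, hπE⟩
  · rw [adjoin.finrank hint]
    have hdvd : minpoly ℚ_[2] α ∣ X ^ 2 - C 2 := minpoly.dvd ℚ_[2] α heval
    have hne : (X ^ 2 - C (2 : ℚ_[2])) ≠ 0 := (monic_X_pow_sub_C 2 (by norm_num)).ne_zero
    calc (minpoly ℚ_[2] α).natDegree ≤ (X ^ 2 - C (2 : ℚ_[2])).natDegree := natDegree_le_of_dvd hdvd hne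
      _ = 2 := natDegree_X_pow_sub_C
  · have hli := WildQuadratic.linearIndependent_one_pi (K := ℚ_[2]⟮α⟯) hπE
    simpa using hli.fintype_card_le_finrank

/-- **NON-VACUITY OF THE WILD DYADIC ISOMETRY MOVER.**  For some finite `E ⊆ ℚ̄₂` (namely `E = ℚ₂(√2)`) there are a
`ℚ₂`-linear ISOMETRY `g` of `E` (mapping `𝒪_E` and every `𝔪_E^n` onto themselves) and a point `z` of the maximal order
`(R_I)^∼` of the two-factor packet `E ⊗_{ℚ₂} E` with `(g ⊗ 1)(z) ∉ (R_I)^∼`.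
[cite: Mochizuki2012, IUTchIV Prop. 1.1 p. 9] [cite: NeukirchANT1999, Ch. II (5.5)] -/
theorem exists_wildQuadratic_isometry_maxOrder_mover :
    ∃ (E : IntermediateField ℚ_[2] (PadicAlgCl 2)) (_ : FiniteDimensional ℚ_[2] E) (g : E ≃ₗ[ℚ_[2]] E),
      (∀ x, ‖g x‖ = ‖x‖) ∧ (∀ r : ℝ, g '' closedBall (0 : E) r = closedBall 0 r) ∧
        ∃ z : PacketAlgebra 2 (fun _ : Fin 2 => (E : Type)),
          z ∈ (normalizedPacket 2 (fun _ : Fin 2 => (E : Type)) : Set (PacketAlgebra 2 (fun _ : Fin 2 => (E : Type)))) ∧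
            (PiTensorProduct.congr (![g, LinearEquiv.refl ℚ_[2] E] : ∀ _ : Fin 2, (E : Type) ≃ₗ[ℚ_[2]] E) :
                PacketAlgebra 2 (fun _ : Fin 2 => (E : Type)) ≃ₗ[ℚ_[2]] PacketAlgebra 2 (fun _ : Fin 2 => (E : Type))) z ∉
              (normalizedPacket 2 (fun _ : Fin 2 => (E : Type)) : Set (PacketAlgebra 2 (fun _ : Fin 2 => (E : Type)))) := by
  obtain ⟨E, π, hfd, hK, hπ⟩ := exists_wildQuadratic_subfield
  exact ⟨E, hfd, WildQuadratic.exists_isometry_maxOrder_mover (K := E) hK hπ⟩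

end Literature.IUT.LogVolume

end
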